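/-
Copyright: the b2b-balaban T⁴-continuum CRUX team, row NE7b OWNER lineage `t4-ne7b-p1` (gen 106). Project licence.
-/
import Summits.QuantumFields.BalabanUV.T4Continuum.Spine.NE7b.StabilityWindowSandwich
import Mathlib.MeasureTheory.Constructions.Pi

/-!
# POSITIVITY ALONE ON THE PINNED REGION: with a COMPACT near fibre (a finite reference measure — Haar — instead of a kept Gaussian) the
# conditional moment costs `e^{i⁺}·κ(F)∕κ(G)` — the interaction's smallness on the window and the LOG OF A VOLUME RATIO, i.e. a price
# PER DEGREE OF FREEDOM of the region, never a sup of the action there (row NE7b, node U5c; the refuter's Q-ne7bref-g68-1, reading (n))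

Cell `pub-balaban`, sub-cell `t4`, spine estimate NE7b (`T4WeightBudget.RelWeightBound`; the cell's OWN estimate — NOT PRINTED in
[Bałaban 1983–89], NOT PROVED).  Crux-route work under `Spine/NE7b/` by the row's OWNER; NOTHING of Bałaban's is named or asserted;
no `T4Continuum/Support` leaf typed; no `def`; zero `sorry`.

WHY.  The refuter's one surviving question for the sandwich ∕ tilt ∕ convexity roads (PRICING-NE7b v72 F394, Q-ne7bref-g68-1): «what
bounds the fresh near fields on the pinned region from above in the cell's carrier — (h) the hierarchy, (c) the chart's injectivity
radius, or (n) nothing (then … the numerator on `Z` must be carried by positivity ALONE — print's road: no chart, Haar measure,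
`e^{−A∕g²} ≤ e^{−cp₀²}` and a bounded integrand — which is a different carrier than `F₁ᴺ·e^{Q₁}·e^{−S−V}` on `ℝ^{n₁}`)».  Print, read this
gen: at a CREATION step the small factor is POINTWISE — [Balaban1989LargeFieldI] p. 175 (0.1) «The term in the Wilson action,
corresponding to the plaquette p, gives the estimate exp[−(1∕g₀²)[1 − Re tr U(∂p)]] ≦ exp(−p₀(g₀))» — and the variables of a large-field
region are group-valued (compact), while the 𝐑-operation later integrates only variables windowed by the hierarchy's small-field
functions ([Balaban1989LargeFieldI] p. 177 (ii), p. 178 (1.3)–(1.9), e.g. (1.9) «χ({sup_{b∈□′}|A_j(b)| < g_j⁻¹δ_j})», p. 179 «the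
integrations … with respect to the variables localized in Z_{j+1}∖Z′_{j+1} … almost the same situation as in the one-step
renormalization transformations»).  THIS FILE types reading (n)'s mechanism as a kernel theorem, in the one-sided letters of
`…StabilityWindowSandwich` but with the near block a FINITE measure space `(K, κ)` (think: Haar on `G^{bonds(Z)}`) and NO Gaussian
kept there: numerator near factor `F ≥ 0`, denominator window `G ≥ 0` with `∫G dκ > 0`, far weight `w ≥ 0` on any `(Y, μ)`, and an
INTERACTION `I(x₁, y)` (every action term touching the region) with (a) `I ≥ 0` on the numerator's support — POSITIVITY, nothing
else — and (b) `I ≤ i⁺` on the window's support (small fields next to small fields).  Then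
**`∫ F·w·e^{−I} ≤ e^{i⁺}·(∫F dκ ∕ ∫G dκ)·∫ G·w·e^{−I}`**: the price is `i⁺ + log(κ(F)∕κ(G))` — for a probability `κ` and a product
window the LOG OF THE INVERSE WINDOW VOLUME, a sum over the region's degrees of freedom (`neg_log_prod`) = Dimock's «per-site cost
`O(1)(−log λ_j)` for the bounded fluctuation fields, still beaten by the extracted `p_j²`» (arXiv:1304.0705 (186), cited in
`…LocalConditionalStability`'s docstring) and [Balaban1989LargeFieldII] p. 380's «constant with the logarithms» IN KIND.  No sup of
the action on the region, no chart radius, no convexity enters.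

WHAT IS PROVED ([folklore]; `integral_prod_mul` (Fubini for products), the owner's `integral_le_of_sandwich₂`, `Measure.pi_pi`, `Real.log_prod`):
**`compactFibre_moment_le`** (the display), `compactFibre_moment_le_exp` (the same with the price written `e^{i⁺ + log(∫F∕∫G)}`),
`pi_window_measure` (`κ(Π_b W_b) = Π_b κ_b(W_b)` for a finite product of s-finite measures, real form), `neg_log_prod` (the per-site sum).

NOT HERE (honest): that Bałaban's creation-step carrier IS of this form with `I ≥ 0` from the positivity of the Wilson action and
`i⁺`, `κ(G)` from the hierarchy's windows ((A3) ∕ (A1c) readings; the page loci above are where print decides it); the pointwise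
extraction (0.1) itself (the other half, `…LocalConditionalStability.chebyshev_extraction` in kind); anything of Bałaban's.  NE7b NOT
PRINTED ∕ NOT PROVED; spine PROVED 0∕9; rung (B)+1 on a FINITE torus — NOT infinite volume, NOT the mass gap, NOT Clay.
HONEST DEPENDENCY: continuum YM on T⁴ ⇐ BetaPertH ∧ nine spine estimates (0/9 proved); BetaPertH ⇐ (D1) ∧ (D4) ∧ CAP+tail.
-/

set_option autoImplicit false

open MeasureTheory Real Finset
open Summit.QuantumFields.BalabanUV.T4Continuum.NE7b.StabilityWindowSandwich

namespace Summit.QuantumFields.BalabanUV.T4Continuum.NE7b.CompactFibreCarrier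

/-! ## §1 The compact-fibre moment bound: positivity on the numerator, smallness on the window, a volume ratio -/

section Moment

variable {K Y : Type*} [MeasurableSpace K] [MeasurableSpace Y] (κ : Measure K) (μ : Measure Y) [SFinite κ] [SFinite μ]

/-- **POSITIVITY ALONE ON THE NEAR FIBRE.**  Near fibre `(K, κ)` (finite ∕ Haar-type; NO Gaussian kept), far space `(Y, μ)`; numerator
near factor `F ≥ 0`, denominator window `G ≥ 0` with `∫G dκ > 0`, far weight `w ≥ 0`, interaction `I` with `0 ≤ I` wherever
`F(x₁)·w(y) ≠ 0` (positivity of the action terms touching the region) and `I ≤ i⁺` wherever `G(x₁)·w(y) ≠ 0` (smallness on the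
window); integrability of `F·w` and of `G·w·e^{−I}` displayed.  Then
`∫ F(x₁)w(y)e^{−I} d(κ⊗μ) ≤ e^{i⁺}·(∫F dκ ∕ ∫G dκ)·∫ G(x₁)w(y)e^{−I} d(κ⊗μ)`. [folklore] -/
theorem compactFibre_moment_le (F G : K → ℝ) (w : Y → ℝ) (I : K × Y → ℝ) {ip : ℝ}
    (hF0 : ∀ x, 0 ≤ F x) (hG0 : ∀ x, 0 ≤ G x) (hw0 : ∀ y, 0 ≤ w y)
    (hIpos : ∀ z : K × Y, F z.1 ≠ 0 → w z.2 ≠ 0 → 0 ≤ I z)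
    (hIsmall : ∀ z : K × Y, G z.1 ≠ 0 → w z.2 ≠ 0 → I z ≤ ip)
    (hGpos : 0 < ∫ x, G x ∂κ)
    (hA : Integrable (fun z : K × Y => F z.1 * w z.2) (κ.prod μ))
    (hB' : Integrable (fun z : K × Y => G z.1 * w z.2 * exp (-I z)) (κ.prod μ)) :
    ∫ z, F z.1 * w z.2 * exp (-I z) ∂(κ.prod μ) ≤
      (exp ip * ((∫ x, F x ∂κ) / ∫ x, G x ∂κ)) * ∫ z, G z.1 * w z.2 * exp (-I z) ∂(κ.prod μ) := by
  have hC : 0 ≤ (∫ x, F x ∂κ) / ∫ x, G x ∂κ := div_nonneg (integral_nonneg hF0) hGpos.le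
  -- Fubini for the two unperturbed product integrands
  have eA : ∫ z, F z.1 * w z.2 ∂(κ.prod μ) = (∫ x, F x ∂κ) * ∫ y, w y ∂μ := integral_prod_mul F w
  have eB : ∫ z, G z.1 * w z.2 ∂(κ.prod μ) = (∫ x, G x ∂κ) * ∫ y, w y ∂μ := integral_prod_mul G w
  have hmom : ∫ z, F z.1 * w z.2 ∂(κ.prod μ) ≤ (∫ x, F x ∂κ) / (∫ x, G x ∂κ) * ∫ z, G z.1 * w z.2 ∂(κ.prod μ) := by
    rw [eA, eB, ← mul_assoc, div_mul_cancel₀ _ hGpos.ne']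
  have key := integral_le_of_sandwich₂ (κ.prod μ) (v₁ := 0) (v₂ := ip) hC
    (A := fun z : K × Y => F z.1 * w z.2) (B := fun z : K × Y => G z.1 * w z.2)
    (A' := fun z : K × Y => F z.1 * w z.2 * exp (-I z)) (B' := fun z : K × Y => G z.1 * w z.2 * exp (-I z))
    (fun z => mul_nonneg (mul_nonneg (hF0 _) (hw0 _)) (exp_pos _).le) (fun z => mul_nonneg (hG0 _) (hw0 _))
    (fun z => mul_exp_neg_le_of_stability (mul_nonneg (hF0 _) (hw0 _)) fun hne => by
      rw [neg_zero]; exact hIpos z (left_ne_zero_of_mul hne) (right_ne_zero_of_mul hne))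
    (fun z => le_mul_exp_neg_of_small (mul_nonneg (hG0 _) (hw0 _)) fun hne =>
      hIsmall z (left_ne_zero_of_mul hne) (right_ne_zero_of_mul hne))
    hA hB' hmom
  rwa [zero_add] at key

/-- The same with the price in the exponent: `e^{i⁺ + log(∫F∕∫G)}` when `∫F dκ > 0` — «smallness on the window plus the LOG OF A
VOLUME RATIO». [folklore] -/
theorem compactFibre_moment_le_exp (F G : K → ℝ) (w : Y → ℝ) (I : K × Y → ℝ) {ip : ℝ}
    (hF0 : ∀ x, 0 ≤ F x) (hG0 : ∀ x, 0 ≤ G x) (hw0 : ∀ y, 0 ≤ w y)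
    (hIpos : ∀ z : K × Y, F z.1 ≠ 0 → w z.2 ≠ 0 → 0 ≤ I z)
    (hIsmall : ∀ z : K × Y, G z.1 ≠ 0 → w z.2 ≠ 0 → I z ≤ ip)
    (hFpos : 0 < ∫ x, F x ∂κ) (hGpos : 0 < ∫ x, G x ∂κ)
    (hA : Integrable (fun z : K × Y => F z.1 * w z.2) (κ.prod μ))
    (hB' : Integrable (fun z : K × Y => G z.1 * w z.2 * exp (-I z)) (κ.prod μ)) :
    ∫ z, F z.1 * w z.2 * exp (-I z) ∂(κ.prod μ) ≤
      exp (ip + Real.log ((∫ x, F x ∂κ) / ∫ x, G x ∂κ)) * ∫ z, G z.1 * w z.2 * exp (-I z) ∂(κ.prod μ) := by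
  rw [exp_add, exp_log (div_pos hFpos hGpos)]
  exact compactFibre_moment_le κ μ F G w I hF0 hG0 hw0 hIpos hIsmall hGpos hA hB'

end Moment

/-! ## §2 The volume ratio is a PER-DEGREE-OF-FREEDOM price for product windows -/

section PerSite

/-- **A PRODUCT WINDOW HAS PRODUCT MEASURE** (finite product of s-finite measures, real form): `κ(Π_b W_b) = Π_b κ_b(W_b)`. [folklore] -/
theorem pi_window_measure {ι : Type*} [Fintype ι] {E : ι → Type*} [∀ b, MeasurableSpace (E b)] (κ : (b : ι) → Measure (E b))
    [∀ b, SigmaFinite (κ b)] (W : (b : ι) → Set (E b)) :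
    ((Measure.pi κ) (Set.univ.pi W)).toReal = ∏ b, ((κ b) (W b)).toReal := by
  rw [Measure.pi_pi, ENNReal.toReal_prod]

/-- **THE LOG OF THE INVERSE WINDOW VOLUME IS A SUM OVER THE DEGREES OF FREEDOM**: `−log(Π_b p_b) = Σ_b (−log p_b)` for `p_b > 0` —
«a per-site cost `O(1)(−log λ_j)`» in kind. [folklore] -/
theorem neg_log_prod {ι : Type*} (s : Finset ι) (p : ι → ℝ) (hp : ∀ b ∈ s, 0 < p b) :
    -Real.log (∏ b ∈ s, p b) = ∑ b ∈ s, -Real.log (p b) := by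
  rw [Real.log_prod fun b hb => (hp b hb).ne', Finset.sum_neg_distrib]

/-- Hence for a probability near fibre with a product window of per-factor masses `p_b ∈ (0, 1]` and `∫F dκ ≤ 1`, the volume-ratio
price `log(∫F∕κ(W))` is at most `Σ_b (−log p_b)`. [folklore] -/
theorem log_volumeRatio_le {ι : Type*} (s : Finset ι) (p : ι → ℝ) (hp : ∀ b ∈ s, 0 < p b) {a : ℝ} (ha0 : 0 < a) (ha1 : a ≤ 1) :
    Real.log (a / ∏ b ∈ s, p b) ≤ ∑ b ∈ s, -Real.log (p b) := by
  have hP : 0 < ∏ b ∈ s, p b := Finset.prod_pos hp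
  rw [Real.log_div ha0.ne' hP.ne', ← neg_log_prod s p hp]
  have : Real.log a ≤ 0 := Real.log_nonpos ha0.le ha1
  linarith

end PerSite

end Summit.QuantumFields.BalabanUV.T4Continuum.NE7b.CompactFibreCarrier
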